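import Literature.MeasureTheory.Group.InvariantQuotientUniqueness
import HarnessLib

/-!
# Integration in stages on homogeneous spaces: `∫_{G ⧸ H} = c ∫_{G ⧸ L} ∫_{L ⧸ H}`
(Bourbaki, *Intégration*, Ch. VII §2 no. 8, Prop. 13 (transitivity of quasi-invariant measures);
Reiter–Stegeman, *Classical Harmonic Analysis and Locally Compact Groups* (2000), §8.1;
Folland (1995), §2.6)

Topic `MeasureTheory/Group`; namespace `Literature.MeasureTheory.Group`. Sequel to
`InvariantQuotientUnfolding` (Weil's formula `∫_{G ⧸ H} ∫_H = c ∫_G` for a *given* invariant measure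
on the coset space) and `InvariantQuotientUniqueness`. Let `G` be a locally compact, second
countable Hausdorff group and `H ≤ L ≤ G` closed subgroups; let `μ_{G/H}`, `μ_{G/L}` be `G`-invariant
Borel measures on `G ⧸ H`, `G ⧸ L`, and `μ_{L/H}` an `L`-invariant Borel measure on
`L ⧸ (H ⊓ L)` (Mathlib: `L ⧸ H.subgroupOf L`), all finite on compact sets and non-zero. Then there
is a constant `c ∈ (0, ∞)` such that for every Borel `f : G ⧸ H → [0, ∞]`

  `∫_{G ⧸ H} f dμ_{G/H} = c ∫_{G ⧸ L} ( ∫_{L ⧸ H ⊓ L} f(g ℓ H) dμ_{L/H}(ℓ) ) dμ_{G/L}(gL)`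

(`exists_lintegral_eq_mul_lintegral_innerLIntegral`): **integration over `G ⧸ H` may be done in
stages, first over the fibres `gL/H ≅ L/(H ⊓ L)` and then over `G ⧸ L`.** No unimodularity is
assumed beyond what is implicit in the existence of the three invariant measures.

Proof. Apply Weil's formula three times — on `G ⧸ H`, on `G ⧸ L`, and on `L ⧸ (H ⊓ L)` for the
group `L` — with Haar measures `ν_G`, `ρ_L`, `ρ_H`: for Borel `φ ≥ 0` on `G`,
`∫_{G/H} φ^H dμ_{G/H} = c₁ ∫_G φ`, `∫_{G/L} φ^L dμ_{G/L} = c₂ ∫_G φ`, and, fibrewise,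
`φ^L(gL) = ∫_L φ(gℓ) dρ_L = c₃⁻¹ ∫_{L/H⊓L} φ^H(gℓH) dμ_{L/H}`, whence the formula for all `f` of the
form `φ^H`; and every Borel `f ≥ 0` on `G ⧸ H` is of this form, `f = (f ∘ π · β / β^H ∘ π)^H` with
`β` the test function of `exists_measurable_fiberLIntegral_pos_lt_top` (`0 < β^H < ∞`).

Contents:

* `inclQuot H L : L ⧸ H.subgroupOf L → G ⧸ H` (**definition**, `ℓ (H ⊓ L) ↦ ℓ H`), `inclQuot_mk`,
  `smul_inclQuot` (`L`-equivariance), `continuous_inclQuot`;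
* `innerLIntegral H L μ_{L/H} f : G ⧸ L → [0, ∞]` (**definition**, the fibre integral
  `gL ↦ ∫_{L ⧸ H⊓L} f(g • ℓH) dμ_{L/H}`, well defined by `L`-invariance of `μ_{L/H}`),
  `innerLIntegral_mk`, `innerLIntegral_mul_comp_quotientMapOfLE` (an `L`-invariant factor comes
  out);
* `fiberLIntegral_subgroupOf_eq` — the fibre integral over `H ⊓ L ≤ L` for the transported Haar
  measure is the fibre integral over `H`;
* `exists_lintegral_eq_mul_lintegral_innerLIntegral` (**the chain rule**), and its weighted form
  `exists_lintegral_mul_eq_mul_lintegral_innerLIntegral_mul`.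

This is the tool that turns the pointwise identities of the Fourier–Whittaker tower on
`GL_n(𝔸_K)` (discrete fibres `P_m(K)\GL_m(K)`, compact fibres `K^m\𝔸_K^m`) into identities of
integrals over `P_n(K)\GL_n(𝔸_K)` and `N_n(𝔸_K)\GL_n(𝔸_K)` (Jacquet–Shalika (1981), §4;
Cogdell (2004), §1.1, §2.3).

## References

* N. Bourbaki, *Intégration*, Ch. VII, §2, no. 8.
* H. Reiter, J. D. Stegeman, *Classical Harmonic Analysis and Locally Compact Groups*, 2nd ed.
  (2000), §8.1.
* G. B. Folland, *A Course in Abstract Harmonic Analysis* (1995), §2.6, Thm. 2.49 [Folland1995].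
* J. R. Getz, H. Hahn, *An Introduction to Automorphic Representations* (2024), Thm. 3.2.2
  [GetzHahn2024].
-/

noncomputable section

open _root_.MeasureTheory _root_.MeasureTheory.Measure _root_.Topology Set Filter
open scoped ENNReal NNReal Pointwise

/- Work with Borel structures on the coset spaces, as in `InvariantQuotientUnfolding`. -/
attribute [-instance] Quotient.instMeasurableSpace QuotientGroup.measurableSpace

namespace Literature.MeasureTheory.Group

/-! ### The inclusion of coset spaces `L ⧸ (H ⊓ L) → G ⧸ H` -/

section Incl

variable {G : Type*} [Group G] (H L : Subgroup G)

/-- **The map of coset spaces induced by `L ≤ G`**: `inclQuot H L (ℓ (H ⊓ L)) = ℓ H`, from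
`L ⧸ H.subgroupOf L` to `G ⧸ H` (well defined: `a⁻¹ b ∈ H ⊓ L` implies `a⁻¹ b ∈ H`). [folklore] -/
def inclQuot : L ⧸ H.subgroupOf L → G ⧸ H :=
  Quotient.map' (fun x : L => (x : G)) fun a b hab => by
    rw [QuotientGroup.leftRel_apply] at hab ⊢
    simpa [Subgroup.mem_subgroupOf] using hab

/-- `inclQuot` on classes (definitional). [folklore] -/
@[simp]
theorem inclQuot_mk (x : L) :
    inclQuot H L (QuotientGroup.mk x : L ⧸ H.subgroupOf L) = QuotientGroup.mk (x : G) :=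
  rfl

/-- **`L`-equivariance**: `ℓ • inclQuot z = inclQuot (ℓ • z)`. [folklore] -/
theorem smul_inclQuot (ℓ : L) (z : L ⧸ H.subgroupOf L) :
    (ℓ : G) • inclQuot H L z = inclQuot H L (ℓ • z) := by
  induction z using QuotientGroup.induction_on with
  | H x => rfl

/-- `inclQuot` is injective. [folklore] -/
theorem inclQuot_injective : Function.Injective (inclQuot H L) := by
  intro z z' h
  induction z using QuotientGroup.induction_on with
  | H x =>
    induction z' using QuotientGroup.induction_on with
    | H x' =>
      rw [inclQuot_mk, inclQuot_mk, QuotientGroup.eq] at h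
      exact QuotientGroup.eq.2 (by rw [Subgroup.mem_subgroupOf, Subgroup.coe_mul, Subgroup.coe_inv]; exact h)

/-- `inclQuot` is continuous (quotient topologies). [folklore] -/
theorem continuous_inclQuot [TopologicalSpace G] : Continuous (inclQuot H L) :=
  Continuous.quotient_map' continuous_subtype_val _

end Incl

/-! ### The inner fibre integral over `L ⧸ (H ⊓ L)` -/

section Inner

variable {G : Type*} [Group G] [TopologicalSpace G] [IsTopologicalGroup G] (H L : Subgroup G)
  [MeasurableSpace (L ⧸ H.subgroupOf L)] [BorelSpace (L ⧸ H.subgroupOf L)]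
  (μLH : Measure (L ⧸ H.subgroupOf L)) [SMulInvariantMeasure L (L ⧸ H.subgroupOf L) μLH]

/-- **The inner fibre integral** `innerLIntegral H L μ_{L/H} f (gL) = ∫_{L ⧸ H⊓L} f(g • ℓH) dμ_{L/H}`
of `f : G ⧸ H → [0, ∞]` over the fibre of `G ⧸ H → G ⧸ L` above `gL`, computed in the model
`L ⧸ (H ⊓ L)` translated by `g` (well defined: replacing `g` by `g ℓ₀`, `ℓ₀ ∈ L`, composes the
integrand with the measure-preserving `z ↦ ℓ₀ • z`). [folklore] -/
def innerLIntegral (f : G ⧸ H → ℝ≥0∞) : G ⧸ L → ℝ≥0∞ := fun y =>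
  Quotient.liftOn' y (fun g => ∫⁻ z, f (g • inclQuot H L z) ∂μLH) fun a b hab => by
    rw [QuotientGroup.leftRel_apply] at hab
    have key : ∀ z, f (b • inclQuot H L z) = f (a • inclQuot H L ((⟨a⁻¹ * b, hab⟩ : L) • z)) :=
      fun z => by rw [← smul_inclQuot, smul_smul, Subgroup.coe_mk, mul_inv_cancel_left]
    show ∫⁻ z, f (a • inclQuot H L z) ∂μLH = ∫⁻ z, f (b • inclQuot H L z) ∂μLH
    simp_rw [key]
    exact ((measurePreserving_smul (⟨a⁻¹ * b, hab⟩ : L) μLH).lintegral_comp_emb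
      (measurableEmbedding_const_smul _) (fun z => f (a • inclQuot H L z))).symm

/-- `innerLIntegral` on classes (definitional). [folklore] -/
@[simp]
theorem innerLIntegral_mk (f : G ⧸ H → ℝ≥0∞) (g : G) :
    innerLIntegral H L μLH f (QuotientGroup.mk g) = ∫⁻ z, f (g • inclQuot H L z) ∂μLH :=
  rfl

variable [MeasurableSpace (G ⧸ H)] [BorelSpace (G ⧸ H)]

/-- The translated inclusion `z ↦ g • inclQuot z` is measurable (Borel structures). [folklore] -/
theorem measurable_smul_inclQuot (g : G) : Measurable fun z : L ⧸ H.subgroupOf L => g • inclQuot H L z :=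
  (measurable_const_smul g).comp (continuous_inclQuot H L).measurable

/-- **An `L`-invariant factor comes out of the inner integral**: for Borel `f : G ⧸ H → [0, ∞]` and
`F : G ⧸ L → [0, ∞]`, `innerLIntegral (f · F ∘ π_{H,L}) = innerLIntegral f · F`,
`π_{H,L} : G ⧸ H → G ⧸ L` the canonical map (Mathlib `Subgroup.quotientMapOfLE`). [folklore] -/
theorem innerLIntegral_mul_comp_quotientMapOfLE (hHL : H ≤ L) {f : G ⧸ H → ℝ≥0∞} (hf : Measurable f)
    (F : G ⧸ L → ℝ≥0∞) (y : G ⧸ L) :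
    innerLIntegral H L μLH (fun x => f x * F (Subgroup.quotientMapOfLE hHL x)) y =
      innerLIntegral H L μLH f y * F y := by
  induction y using QuotientGroup.induction_on with
  | H g =>
    rw [innerLIntegral_mk, innerLIntegral_mk]
    have h1 : ∀ z : L ⧸ H.subgroupOf L,
        F (Subgroup.quotientMapOfLE hHL (g • inclQuot H L z)) = F (QuotientGroup.mk g) := by
      intro z
      induction z using QuotientGroup.induction_on with
      | H x =>
        rw [inclQuot_mk, MulAction.Quotient.smul_mk, Subgroup.quotientMapOfLE_apply_mk]
        congr 1
        exact QuotientGroup.eq.2 (by simp)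
    simp_rw [h1]
    exact lintegral_mul_const _ (hf.comp (measurable_smul_inclQuot H L g))

end Inner

/-! ### Topological preliminaries on `H ⊓ L ≤ L` -/

section TopAux

variable {G : Type*} [Group G] [TopologicalSpace G] (H L : Subgroup G)

/-- The isomorphism `H.subgroupOf L ≃* H` (Mathlib `Subgroup.subgroupOfEquivOfLe`) is continuous.
[folklore] -/
theorem continuous_subgroupOfEquivOfLe (hHL : H ≤ L) : Continuous (Subgroup.subgroupOfEquivOfLe hHL) :=
  Continuous.subtype_mk (continuous_subtype_val.comp continuous_subtype_val) _

/-- Its inverse is continuous. [folklore] -/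
theorem continuous_subgroupOfEquivOfLe_symm (hHL : H ≤ L) :
    Continuous (Subgroup.subgroupOfEquivOfLe hHL).symm :=
  Continuous.subtype_mk (Continuous.subtype_mk continuous_subtype_val _) _

/-- The subgroup `H ⊓ L ≤ L` is closed in `L` when `H` is closed in `G`. [folklore] -/
theorem isClosed_subgroupOf (hH : IsClosed (H : Set G)) :
    IsClosed ((H.subgroupOf L : Subgroup L) : Set L) :=
  hH.preimage continuous_subtype_val

/-- The canonical map `G ⧸ H → G ⧸ L` (`H ≤ L`, Mathlib `Subgroup.quotientMapOfLE`) is continuous.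
[folklore] -/
theorem continuous_quotientMapOfLE (hHL : H ≤ L) : Continuous (Subgroup.quotientMapOfLE hHL) :=
  Continuous.quotient_map' continuous_id _

end TopAux

/-! ### The fibre integral over `H ⊓ L ≤ L` -/

section SubgroupOf

variable {G : Type*} [Group G] [TopologicalSpace G] [IsTopologicalGroup G]
  [MeasurableSpace G] [BorelSpace G] (H L : Subgroup G) (hHL : H ≤ L)

/-- The isomorphism `H ≃ H.subgroupOf L` as a measurable equivalence (Borel structures). [folklore] -/
def subgroupOfMeasurableEquiv : H ≃ᵐ H.subgroupOf L :=
  (Homeomorph.mk (Subgroup.subgroupOfEquivOfLe hHL).symm.toEquiv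
    (continuous_subgroupOfEquivOfLe_symm H L hHL) (continuous_subgroupOfEquivOfLe H L hHL)).toMeasurableEquiv

omit [IsTopologicalGroup G] in
/-- `subgroupOfMeasurableEquiv` is `(subgroupOfEquivOfLe hHL).symm` as a map (definitional). [folklore] -/
@[simp]
theorem coe_subgroupOfMeasurableEquiv :
    ⇑(subgroupOfMeasurableEquiv H L hHL) = (Subgroup.subgroupOfEquivOfLe hHL).symm := rfl

/-- **The fibre integral over `H ⊓ L ≤ L`, for the Haar measure transported from `H`, is the fibre
integral over `H`**: for `φ : G → [0, ∞]`, `g ∈ G`, `x ∈ L` and `ρ' = (e⁻¹)_* ρ_H`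
(`e : H ⊓ L ≃ H`), `fiberLIntegral (H.subgroupOf L) ρ' (ℓ ↦ φ(g ℓ)) (x) = fiberLIntegral H ρ_H φ (g x)`.
[folklore] -/
theorem fiberLIntegral_subgroupOf_eq (ρH : Measure H) [ρH.IsMulLeftInvariant]
    (ρ' : Measure (H.subgroupOf L)) [ρ'.IsMulLeftInvariant]
    (hρ' : ρ' = Measure.map (Subgroup.subgroupOfEquivOfLe hHL).symm ρH) (φ : G → ℝ≥0∞)
    (g : G) (x : L) :
    fiberLIntegral (H.subgroupOf L) ρ' (fun ℓ : L => φ (g * ℓ)) (QuotientGroup.mk x) =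
      fiberLIntegral H ρH φ (QuotientGroup.mk (g * x)) := by
  rw [fiberLIntegral_mk, fiberLIntegral_mk, hρ', ← coe_subgroupOfMeasurableEquiv H L hHL,
    lintegral_map_equiv]
  refine lintegral_congr fun h => ?_
  simp [Subgroup.coe_mul, mul_assoc]

end SubgroupOf

/-! ### The chain rule -/

section Chain

variable {G : Type*} [Group G] [TopologicalSpace G] [IsTopologicalGroup G] [LocallyCompactSpace G]
  [SecondCountableTopology G] [T2Space G] [MeasurableSpace G] [BorelSpace G]
  (H L : Subgroup G) [hH : IsClosed (H : Set G)] [hL : IsClosed (L : Set G)]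
  [MeasurableSpace (G ⧸ H)] [BorelSpace (G ⧸ H)] [MeasurableSpace (G ⧸ L)] [BorelSpace (G ⧸ L)]
  [MeasurableSpace (L ⧸ H.subgroupOf L)] [BorelSpace (L ⧸ H.subgroupOf L)]
  (μGH : Measure (G ⧸ H)) [SMulInvariantMeasure G (G ⧸ H) μGH] [IsFiniteMeasureOnCompacts μGH]
  (μGL : Measure (G ⧸ L)) [SMulInvariantMeasure G (G ⧸ L) μGL] [IsFiniteMeasureOnCompacts μGL]
  (μLH : Measure (L ⧸ H.subgroupOf L)) [SMulInvariantMeasure L (L ⧸ H.subgroupOf L) μLH]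
  [IsFiniteMeasureOnCompacts μLH]

/-- **Integration in stages (the chain rule for invariant measures on coset spaces).** Let `G` be a
locally compact second countable Hausdorff group, `H ≤ L ≤ G` closed subgroups, `μ_{G/H}`,
`μ_{G/L}` `G`-invariant Borel measures on `G ⧸ H`, `G ⧸ L` and `μ_{L/H}` an `L`-invariant Borel
measure on `L ⧸ (H ⊓ L)`, all finite on compact sets and non-zero. Then there is `c ∈ (0, ∞)` with
`∫_{G ⧸ H} f dμ_{G/H} = c ∫_{G ⧸ L} (∫_{L ⧸ H⊓L} f(g • ℓH) dμ_{L/H}) dμ_{G/L}(gL)` for every Borel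
`f : G ⧸ H → [0, ∞]` (Bourbaki, *Intégration* VII §2 no. 8; Reiter–Stegeman (2000), §8.1; here from
three applications of Weil's formula, Folland (1995), Thm. 2.49). [cite: Folland1995, §2.6 Thm. 2.49] -/
theorem exists_lintegral_eq_mul_lintegral_innerLIntegral (hHL : H ≤ L) (hGH : μGH ≠ 0)
    (hGL : μGL ≠ 0) (hLH : μLH ≠ 0) :
    ∃ c : ℝ≥0∞, c ≠ 0 ∧ c ≠ ∞ ∧ ∀ f : G ⧸ H → ℝ≥0∞, Measurable f →
      ∫⁻ x, f x ∂μGH = c * ∫⁻ y, innerLIntegral H L μLH f y ∂μGL := by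
  -- the closed subgroups as locally compact second countable groups
  haveI : LocallyCompactSpace L := hL.isClosedEmbedding_subtypeVal.locallyCompactSpace
  haveI : LocallyCompactSpace H := hH.isClosedEmbedding_subtypeVal.locallyCompactSpace
  haveI : SecondCountableTopology L := TopologicalSpace.Subtype.secondCountableTopology _
  haveI : SecondCountableTopology H := TopologicalSpace.Subtype.secondCountableTopology _
  haveI : SecondCountableTopology (H.subgroupOf L) := TopologicalSpace.Subtype.secondCountableTopology _
  haveI : IsClosed ((H.subgroupOf L : Subgroup L) : Set L) := isClosed_subgroupOf H L hH
  haveI : LocallyCompactSpace (H.subgroupOf L) :=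
    (isClosed_subgroupOf H L hH).isClosedEmbedding_subtypeVal.locallyCompactSpace
  -- Haar measures on `G`, `L`, `H`, and the transport of the latter to `H ⊓ L ≤ L`
  obtain ⟨νG, hνG⟩ : ∃ ν : Measure G, IsHaarMeasure ν := ⟨Measure.haar, inferInstance⟩
  obtain ⟨ρL, hρL⟩ : ∃ ρ : Measure L, IsHaarMeasure ρ := ⟨Measure.haar, inferInstance⟩
  obtain ⟨ρH, hρH⟩ : ∃ ρ : Measure H, IsHaarMeasure ρ := ⟨Measure.haar, inferInstance⟩
  obtain ⟨ρHL, hρHLh, hρHL⟩ : ∃ ρ' : Measure (H.subgroupOf L), IsHaarMeasure ρ' ∧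
      ρ' = Measure.map (Subgroup.subgroupOfEquivOfLe hHL).symm ρH :=
    ⟨_, MulEquiv.isHaarMeasure_map ρH (Subgroup.subgroupOfEquivOfLe hHL).symm
      (continuous_subgroupOfEquivOfLe_symm H L hHL) (continuous_subgroupOfEquivOfLe H L hHL), rfl⟩
  have hρH0 : ρH ≠ 0 := fun h => by
    have h2 : 0 < ρH Set.univ := isOpen_univ.measure_pos ρH ⟨1, trivial⟩
    rw [h] at h2; exact lt_irrefl _ h2
  have hρL0 : ρL ≠ 0 := fun h => by
    have h2 : 0 < ρL Set.univ := isOpen_univ.measure_pos ρL ⟨1, trivial⟩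
    rw [h] at h2; exact lt_irrefl _ h2
  have hρHL0 : ρHL ≠ 0 := fun h => by
    have h2 : 0 < ρHL Set.univ := isOpen_univ.measure_pos ρHL ⟨1, trivial⟩
    rw [h] at h2; exact lt_irrefl _ h2
  -- the three unfolding constants
  obtain ⟨c₁, hc₁⟩ : ∃ c : ℝ≥0∞, c = (unfoldingConstant H ρH μGH νG : ℝ≥0∞) := ⟨_, rfl⟩
  obtain ⟨c₂, hc₂⟩ : ∃ c : ℝ≥0∞, c = (unfoldingConstant L ρL μGL νG : ℝ≥0∞) := ⟨_, rfl⟩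
  obtain ⟨c₃, hc₃⟩ : ∃ c : ℝ≥0∞, c = (unfoldingConstant (H.subgroupOf L) ρHL μLH ρL : ℝ≥0∞) :=
    ⟨_, rfl⟩
  have hc1 : c₁ ≠ 0 := by
    rw [hc₁]; exact ENNReal.coe_ne_zero.2 (unfoldingConstant_pos H ρH μGH νG hGH hρH0).ne'
  have hc2 : c₂ ≠ 0 := by
    rw [hc₂]; exact ENNReal.coe_ne_zero.2 (unfoldingConstant_pos L ρL μGL νG hGL hρL0).ne'
  have hc3 : c₃ ≠ 0 := by
    rw [hc₃]
    exact ENNReal.coe_ne_zero.2 (unfoldingConstant_pos (H.subgroupOf L) ρHL μLH ρL hLH hρHL0).ne'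
  have hc1t : c₁ ≠ ∞ := by rw [hc₁]; exact ENNReal.coe_ne_top
  have hc2t : c₂ ≠ ∞ := by rw [hc₂]; exact ENNReal.coe_ne_top
  have hc3t : c₃ ≠ ∞ := by rw [hc₃]; exact ENNReal.coe_ne_top
  have hmk : Measurable (QuotientGroup.mk : G → G ⧸ H) := QuotientGroup.continuous_mk.measurable
  -- (P): the fibre integral over `L` in stages, pointwise
  have hP : ∀ {φ : G → ℝ≥0∞}, Measurable φ → ∀ g : G,
      fiberLIntegral L ρL φ (QuotientGroup.mk g) =
        c₃⁻¹ * innerLIntegral H L μLH (fiberLIntegral H ρH φ) (QuotientGroup.mk g) := by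
    intro φ hφ g
    rw [fiberLIntegral_mk, innerLIntegral_mk]
    have hψ : Measurable fun ℓ : L => φ (g * ℓ) :=
      hφ.comp (continuous_const.mul continuous_subtype_val).measurable
    have h3 := lintegral_fiberLIntegral_eq_mul_lintegral (H.subgroupOf L) ρHL μLH ρL hψ
    have h4 : ∀ z, fiberLIntegral (H.subgroupOf L) ρHL (fun ℓ : L => φ (g * ℓ)) z =
        fiberLIntegral H ρH φ (g • inclQuot H L z) := by
      intro z
      induction z using QuotientGroup.induction_on with
      | H x =>
        rw [fiberLIntegral_subgroupOf_eq H L hHL ρH ρHL hρHL φ g x, inclQuot_mk,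
          MulAction.Quotient.smul_mk, smul_eq_mul]
    simp_rw [h4] at h3
    rw [h3, ← hc₃, ← mul_assoc, ENNReal.inv_mul_cancel hc3 hc3t, one_mul]
  -- (Q): the chain rule for fibre integrals of Borel functions on `G`
  have hQ : ∀ {φ : G → ℝ≥0∞}, Measurable φ →
      ∫⁻ x, fiberLIntegral H ρH φ x ∂μGH =
        c₁ * c₂⁻¹ * c₃⁻¹ * ∫⁻ y, innerLIntegral H L μLH (fiberLIntegral H ρH φ) y ∂μGL := by
    intro φ hφ
    have h1 := lintegral_fiberLIntegral_eq_mul_lintegral H ρH μGH νG hφ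
    have h2 := lintegral_fiberLIntegral_eq_mul_lintegral L ρL μGL νG hφ
    rw [← hc₁] at h1
    rw [← hc₂] at h2
    have h2' : ∫⁻ y, fiberLIntegral L ρL φ y ∂μGL =
        c₃⁻¹ * ∫⁻ y, innerLIntegral H L μLH (fiberLIntegral H ρH φ) y ∂μGL := by
      rw [← lintegral_const_mul' _ _ (ENNReal.inv_ne_top.2 hc3)]
      refine lintegral_congr fun y => ?_
      induction y using QuotientGroup.induction_on with
      | H g => exact hP hφ g
    calc ∫⁻ x, fiberLIntegral H ρH φ x ∂μGH = c₁ * ∫⁻ g, φ g ∂νG := h1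
      _ = c₁ * (c₂⁻¹ * (c₂ * ∫⁻ g, φ g ∂νG)) := by
          rw [← mul_assoc c₂⁻¹, ENNReal.inv_mul_cancel hc2 hc2t, one_mul]
      _ = c₁ * (c₂⁻¹ * (c₃⁻¹ * ∫⁻ y, innerLIntegral H L μLH (fiberLIntegral H ρH φ) y ∂μGL)) := by
          rw [← h2, h2']
      _ = c₁ * c₂⁻¹ * c₃⁻¹ * ∫⁻ y, innerLIntegral H L μLH (fiberLIntegral H ρH φ) y ∂μGL := by
          simp only [mul_assoc]
  -- every Borel `f` on `G ⧸ H` is a fibre integral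
  obtain ⟨β, hβm, hβ⟩ := exists_measurable_fiberLIntegral_pos_lt_top H ρH
  have hbm : Measurable (fiberLIntegral H ρH β) := measurable_fiberLIntegral H ρH hβm
  refine ⟨c₁ * c₂⁻¹ * c₃⁻¹,
    mul_ne_zero (mul_ne_zero hc1 (ENNReal.inv_ne_zero.2 hc2t)) (ENNReal.inv_ne_zero.2 hc3t),
    ENNReal.mul_ne_top (ENNReal.mul_ne_top hc1t (ENNReal.inv_ne_top.2 hc2)) (ENNReal.inv_ne_top.2 hc3),
    fun f hf => ?_⟩
  obtain ⟨φ, hφ⟩ : ∃ φ : G → ℝ≥0∞, φ = fun g =>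
      β g * (f (QuotientGroup.mk g) * (fiberLIntegral H ρH β (QuotientGroup.mk g))⁻¹) := ⟨_, rfl⟩
  have hφm : Measurable φ := by
    rw [hφ]; exact hβm.mul ((hf.comp hmk).mul ((hbm.comp hmk).inv))
  have hfib : fiberLIntegral H ρH φ = f := by
    funext x
    rw [hφ, fiberLIntegral_mul_comp_mk H ρH hβm (fun x => f x * (fiberLIntegral H ρH β x)⁻¹) x,
      mul_comm (f x), ← mul_assoc, ENNReal.mul_inv_cancel (hβ x).1.ne' (hβ x).2.ne, one_mul]
  have := hQ hφm
  rwa [hfib] at this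

/-- **Integration in stages with an `L`-invariant weight**: with the constant `c` of
`exists_lintegral_eq_mul_lintegral_innerLIntegral`, for Borel `f : G ⧸ H → [0, ∞]` and Borel
`w : G ⧸ L → [0, ∞]`,
`∫_{G ⧸ H} f · (w ∘ π_{H,L}) dμ_{G/H} = c ∫_{G ⧸ L} (∫_{L ⧸ H⊓L} f(g • ℓH) dμ_{L/H}) w(gL) dμ_{G/L}`.
[cite: Folland1995, §2.6 Thm. 2.49] -/
theorem exists_lintegral_mul_eq_mul_lintegral_innerLIntegral_mul (hHL : H ≤ L) (hGH : μGH ≠ 0)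
    (hGL : μGL ≠ 0) (hLH : μLH ≠ 0) :
    ∃ c : ℝ≥0∞, c ≠ 0 ∧ c ≠ ∞ ∧
      (∀ f : G ⧸ H → ℝ≥0∞, Measurable f →
        ∫⁻ x, f x ∂μGH = c * ∫⁻ y, innerLIntegral H L μLH f y ∂μGL) ∧
      ∀ f : G ⧸ H → ℝ≥0∞, Measurable f → ∀ w : G ⧸ L → ℝ≥0∞, Measurable w →
        ∫⁻ x, f x * w (Subgroup.quotientMapOfLE hHL x) ∂μGH =
          c * ∫⁻ y, innerLIntegral H L μLH f y * w y ∂μGL := by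
  obtain ⟨c, hc0, hct, h⟩ :=
    exists_lintegral_eq_mul_lintegral_innerLIntegral H L μGH μGL μLH hHL hGH hGL hLH
  refine ⟨c, hc0, hct, h, fun f hf w hw => ?_⟩
  rw [h (fun x => f x * w (Subgroup.quotientMapOfLE hHL x))
    (hf.mul (hw.comp (continuous_quotientMapOfLE H L hHL).measurable))]
  congr 1
  refine lintegral_congr fun y => ?_
  exact innerLIntegral_mul_comp_quotientMapOfLE H L μLH hHL hf w y

end Chain

end Literature.MeasureTheory.Group
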